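import Summits.QuantumFields.YangMills.Theorems.UnitScaleTiltProp7HDOfCombRowsT3
import Summits.QuantumFields.YangMills.Theorems.UnitScaleTiltProp7CombHMc2HoldsT3
import Summits.QuantumFields.YangMills.Theorems.UnitScaleTiltProp7N32SymRowT3
import Summits.QuantumFields.YangMills.Theorems.UnitScaleTiltProp7HcoSOfNormG0DiffRow
import HarnessLib

/-!
# Route `UnitScaleTilt`, crux K1 «MinimiserStabilityRegPr» (stmt-QuantumFields-19200), EX display (v3.38ᴸ) — **THE (β) ROW `hD` AND THE (P-A2) ROW `hPA2` ARE TREE THEOREMS,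
# HYPOTHESIS-FREE; THE GROWTH ROW (141)–(142) `hcoS` NOW RESTS ON (N06)ᶜ ALONE** (route-R v2 second line, lane (β) «COMB = STRAIGHT ∘ BLOCK-AXIAL»: the closing file)

Cell `ym3-torus`, twin-width seat `ym-routeR-w1` (gen 11; (β)-lane pen-namer, PEN WORD №2).  THEOREMS ONLY (0 `def`, 0 `sorry`, 0 `instance`); default heartbeats;
`--supports stmt-QuantumFields-19200 --as helper`, count-neutral.  YM₃ on T³ is a ladder rung (R3), NOT the Clay problem; nothing here claims the stub `stub_existenceMinimalOrbit`,
the crux, (N06)ᶜ, d = 4 or the mass gap.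

WHY.  ★★OWNER RULING №20 (1) (S32ᴸ ✓p709167) descended the (P-A2) row `hPA2` of the EX display into (S) `hS` (✓p700543 `Prop7HcoSOfNormG0DiffRow.hS_holds`), (DV) `hV`
(✓p699177 `Prop7DivSliceRowHolds.hV_holds`) and (β) `hD`, and `hD` (px16 G3 ✓p708782 `Prop7HDOfCombRows.hD_of_hMcomb`) into EXACTLY three labelled route-internal rows:
`hMc` («(n3)-comb»), `hMc₂` («(n3)-comb₂»), `hN2s` («(n3)₂-sym»).  All three are now tree theorems, hypothesis-free:
* `hMc`  = ✓p721589 `Prop7CombHMcombHolds.hMcomb_holds` (★routeR-w1 g10, lane (II) F-2…F-8c-final-2 over ★routeR-w6 ∕ ★routeR-w4 ∕ w3-19200 ∕ w5-19200 ∕ px17 ∕ px18 bricks);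
* `hMc₂` = ✓`Prop7CombHMc2Holds.hMc₂_holds` (routeR-w3 g9) `:= hMc₂_of_hMc_of_hGj hMcomb_holds hGj_holds` (px17 M-4c ✓p722676 ∘ routeR-w3 F-9c-2 ✓p723432 `hGj_holds` over px18 F-9a∕G);
* `hN2s` = ✓p715270 `Prop7N32SymRow.hN2s_holds` (px21 g7 N6c over N6a∕N6b∕N6c-R∕N6c-X∕N6d∕N4∕S∕N5∕N2′).
Hence G3's conclusion `hD` and, through ★p1 g18's ✓`Prop7HcoSOfNormG0DiffRow.hPA2_of_diffL1`, the (P-A2) binder `hPA2` of ✓`Prop7PA2OfSymDiffDivRows.hPA2_of_symL1_diffL1_divSlice`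
are inhabited OUTRIGHT — no displayed row, no window, no letter left on the (β) side.  This file records the two closed forms BY NAME (texts = the tree binders, pulled by script
from ✓p708782 :119–:131 and ✓`hPA2_of_diffL1`'s conclusion; proofs are single terms) and re-reads the E′ growth socket: ✓`hcoS_of_normG0_of_diffL1 (ha₀) (hN06) (hD)` with
`hD := hD_holds` is `hcoS ⟸ (N06)ᶜ` — of the two labelled OPEN rows (N06) ∧ (β) of ★p1 g18's architecture (A′), ONE remains.

WHAT THIS IS NOT.  Not an S-event (the EX display of record S38ᴸ ✓p724127 shows `hMc₂` until ★w2-19200's next display; it never showed `hD`∕`hPA2` since S32ᴸ); not a proof of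
(N06)ᶜ (print: [Balaban1985BackgroundPropagators] Thm 3.3 p.399 ∕ Thm 3.11 p.416 — displayed through the lane-II door `hN06_of_divRecovery`); not a proof of `hcoS`, of EX, of the
crux or of any summit statement; not d = 4, not infinite volume, not a mass gap, not Clay.

References: T. Bałaban, CMP 102 (1985) 277–309 [Balaban1985Variational] ((2) p.278, (19)–(20) p.281, (44)–(48) pp.285–286, (106)–(111) p.294, (141)–(142) p.299);
CMP 98 (1985) 17–51 [Balaban1985Averaging] ((89)–(92) p.31, (97) p.32, (122)–(126) p.36); CMP 99 (1985) 389–434 [Balaban1985BackgroundPropagators] (Thm 3.11 p.416).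
-/

set_option autoImplicit false

noncomputable section

open scoped BigOperators Matrix.Norms.L2Operator Matrix Topology InnerProductSpace
open Filter NormedSpace

namespace Summit.QuantumFields.YangMills.Theorems.Prop7PA2Holds

open Literature.MathematicalPhysics.QuantumFieldTheory.Balaban1983to89
open Literature.MathematicalPhysics.QuantumFieldTheory.Balaban1983to89.T3ContinuumYM3Torus
open Literature.MathematicalPhysics.QuantumFieldTheory.Balaban1983to89.T3UnitLawDensityEML (ℰp)
open Literature.MathematicalPhysics.QuantumFieldTheory.Balaban1983to89.T3ConstrainedMinimiser (fibre)
open Literature.MathematicalPhysics.QuantumFieldTheory.Balaban1983to89.T3PrintedRegularMinimiser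
open Literature.MathematicalPhysics.QuantumFieldTheory.Balaban1983to89.T3RegularMinimiser
open Literature.MathematicalPhysics.QuantumFieldTheory.Balaban1983to89.T3Thm1Carrier
open T4Continuum BlockAveraging AveragingRT ExpMeanLog BlockAveragingEMLLinearised BlockAveragingEMLLinearisedBackground BlockAveragingEMLProp2
open B7Prop1Explicit (expUnit)
open B7Eq92Concrete (tildIter)
open B10Eq27TorusAxialLog (pull unitsField toUField)
open B9Eq39Adjoint (divB)
open B9TorusCalculus (torusT)
open T3SectALandauChart (emb15 eta eta_pos bgUnits In19)
open B11Eq103H1Complex (BondL2K laplaceAK)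
open Summit.QuantumFields.YangMills.Theorems.Prop7SPrint (basePt RestrictedPrint AvgCondPrint IsLandauPrint)
open Summit.QuantumFields.YangMills.Theorems.Prop7TPrint (expHermField)
open Summit.QuantumFields.YangMills.Theorems.Prop7SectET3Transport (periodsT3)
open Summit.QuantumFields.YangMills.Theorems.Prop7SectET3HilbertLetters (W₂ toL2 toL2B DL2 DstarL2)
open Summit.QuantumFields.YangMills.Theorems.Prop7SectET3WilsonHessian (DeltaEta DeltaEtaSlot)
open Summit.QuantumFields.YangMills.Theorems.Prop7SectET3CombLetters (Qkc)
open Summit.QuantumFields.YangMills.Theorems.Prop7QprimeCombL2 (RcombL2)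
open Summit.QuantumFields.YangMills.Theorems.Prop7SymAvgTw (frameTw QTw CmapTw)
open Summit.QuantumFields.YangMills.Theorems.Prop7SymAvgTwSym (frameTwS CmapTwS)
open Summit.QuantumFields.YangMills.Theorems.Prop7HDOfCombRows (hD_of_hMcomb)
open Summit.QuantumFields.YangMills.Theorems.Prop7CombHMcombHolds (hMcomb_holds)
open Summit.QuantumFields.YangMills.Theorems.Prop7CombHMc2Holds (hMc₂_holds)
open Summit.QuantumFields.YangMills.Theorems.Prop7N32SymRow (hN2s_holds)
open Summit.QuantumFields.YangMills.Theorems.Prop7HcoSOfNormG0DiffRow (hPA2_of_diffL1 hcoS_of_normG0_of_diffL1)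

/-! ## §1 The (β) row `hD` — closed form -/

/-- ★★★ **THE (β) ROW `hD` HOLDS** — G3 ✓p708782 `Prop7HDOfCombRows.hD_of_hMcomb`'s CONCLUSION VERBATIM (= the `hD` binder of ✓`Prop7PA2OfSymDiffDivRows.hPA2_of_symL1_diffL1_divSlice`):
the `ℓ¹` level mass of the difference of the twisted-comb and the symmetric-comb cross sections `CmapTw − CmapTwS` at a printed-regular `W` on the fibre of `V`, a Σ-representative
`e^{iX}W` in the (19)-window with the averaging condition and the projected Landau condition, in the currency `CD₁·ℓ⁻¹·‖X‖² + CD₂·ℓ·(PLAQ + DIV + δ·ℓ⁻²·‖X‖²)`, constants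
depending on `(L, B₁′)` only.  PROOF = `hD_of_hMcomb hMcomb_holds hMc₂_holds hN2s_holds` — the three OWNER-labelled route-internal rows «(n3)-comb», «(n3)-comb₂», «(n3)₂-sym»
by name (✓p721589, ✓`Prop7CombHMc2Holds.hMc₂_holds`, ✓p715270).
[cite: Balaban1985Variational, (2) p.278, (19)-(20) p.281, (44)-(48) pp.285-286, (106)-(111) p.294; Balaban1985Averaging, (89)-(92) p.31, (97) p.32, (122)-(126) p.36] -/
theorem hD_holds :
    ∀ (L : ℕ), 1 < L → ∀ (B₁' : ℝ), 0 < B₁' → ∃ eD CD₁ CD₂ : ℝ, 0 < eD ∧ 0 ≤ CD₁ ∧ 0 ≤ CD₂ ∧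
      ∀ (F : T3Family), F.L = L → ∀ (n K : ℕ) (hnK : n < K) (e : ℝ) (V : GaugeField (F.P n) 0 (Matrix.specialUnitaryGroup (Fin 2) ℂ))
        (W : GaugeField (F.P K) 0 (Matrix.specialUnitaryGroup (Fin 2) ℂ)) (X : PBond (F.P K) 0 → Matrix (Fin 2) (Fin 2) ℂ),
        0 < e → e ≤ eD → W ∈ regFibrePr F n K hnK.le e V →
        (∀ γ : ℝ → GaugeField (F.P K) 0 (Matrix.specialUnitaryGroup (Fin 2) ℂ), γ 0 = W → (∀ t, γ t ∈ fibre F ℰp n K hnK.le V) →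
          (∀ b, DifferentiableAt ℝ (fun t => ((γ t b : Matrix.specialUnitaryGroup (Fin 2) ℂ) : Matrix (Fin 2) (Fin 2) ℂ)) 0) →
            deriv (fun t => wilsonAction4 (γ t)) 0 = 0) →
        In19 F n K (2 * B₁' * e) W (expHermField X) X → AvgCondPrint F n K hnK.le V W X → IsLandauPrint F n K W X →
          ∑ ĉ : PBond (F.P n) 0, ‖CmapTw F n K hnK.le W (fun b => Complex.I • X b) ĉ - CmapTwS F n K hnK.le W (fun b => Complex.I • X b) ĉ‖
              ≤ CD₁ * ((F.L : ℝ) ^ (K - n))⁻¹ * (∑ b : PBond (F.P K) 0, ‖X b‖ ^ 2) + CD₂ * ((F.L : ℝ) ^ (K - n)) * ((∑ p : Plaq (F.P K) 0, ‖((Complex.I • X ⟨p.src, p.μ⟩) + ((W ⟨p.src, p.μ⟩ : Matrix (Fin 2) (Fin 2) ℂ) * (Complex.I • X ⟨p.src.shift p.μ, p.ν⟩) * star (W ⟨p.src, p.μ⟩ : Matrix (Fin 2) (Fin 2) ℂ))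
            - (((W ⟨p.src, p.μ⟩ * W ⟨p.src.shift p.μ, p.ν⟩ * (W ⟨p.src.shift p.ν, p.μ⟩)⁻¹ : Matrix.specialUnitaryGroup (Fin 2) ℂ) : Matrix (Fin 2) (Fin 2) ℂ) * (Complex.I • X ⟨p.src.shift p.ν, p.μ⟩) * star ((W ⟨p.src, p.μ⟩ * W ⟨p.src.shift p.μ, p.ν⟩ * (W ⟨p.src.shift p.ν, p.μ⟩)⁻¹ : Matrix.specialUnitaryGroup (Fin 2) ℂ) : Matrix (Fin 2) (Fin 2) ℂ))
            - (((GaugeField.plaqHol W p : Matrix.specialUnitaryGroup (Fin 2) ℂ) : Matrix (Fin 2) (Fin 2) ℂ) * (Complex.I • X ⟨p.src, p.ν⟩) * star ((GaugeField.plaqHol W p : Matrix.specialUnitaryGroup (Fin 2) ℂ) : Matrix (Fin 2) (Fin 2) ℂ)))‖ ^ 2) + (∑ x : Site (F.P K) 0, ∑ j : Fin 2, ∑ k : Fin 2,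
              ‖(divB (torusT (F.P K) 0) (fun κ z => unitsField (toUField W) ⟨z, κ⟩) (fun κ z => Complex.I • X ⟨z, κ⟩) x) j k‖ ^ 2)) :=
  hD_of_hMcomb hMcomb_holds hMc₂_holds hN2s_holds

/-! ## §2 The (P-A2) row `hPA2` — closed form -/

/-- ★★★ **THE (P-A2) ROW `hPA2` HOLDS** — ★p1 g18 ✓`Prop7HcoSOfNormG0DiffRow.hPA2_of_diffL1`'s CONCLUSION VERBATIM (= the `hPA2` binder of the EX display up to S31ᴸ and of
✓`Prop7CmapTwSupRow.hcoS_of_normG0_of_combRemainderL1Rows`): the `ℓ¹` comb-remainder row of [Balaban1985Variational] (106)–(111) for the twisted cross section `CmapTw` at a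
Σ-representative, with its divergence-slice companion `dv`, constants `(L, B₁′)`-only.  PROOF = `hPA2_of_diffL1 hD_holds` ((S) ✓p700543 `hS_holds` and (DV) ✓p699177 `hV_holds`
are consumed inside ✓`hPA2_of_diffL1`).  With this the (β)∕(P-A2) side of architecture (A′) carries NO open row.
[cite: Balaban1985Variational, (44)-(47) pp.285-286, (106)-(111) p.294] -/
theorem hPA2_holds :
    ∀ (L : ℕ), 1 < L → ∀ (B₁' : ℝ), 0 < B₁' → ∃ eJ C₁ C₂ ζ δ₁ : ℝ, 0 < eJ ∧ 0 ≤ C₁ ∧ 0 ≤ C₂ ∧ 0 ≤ ζ ∧ 0 ≤ δ₁ ∧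
      ∀ (F : T3Family), F.L = L → ∀ (n K : ℕ) (hnK : n < K) (e : ℝ) (V : GaugeField (F.P n) 0 (Matrix.specialUnitaryGroup (Fin 2) ℂ))
        (W : GaugeField (F.P K) 0 (Matrix.specialUnitaryGroup (Fin 2) ℂ)) (X : PBond (F.P K) 0 → Matrix (Fin 2) (Fin 2) ℂ),
        0 < e → e ≤ eJ → W ∈ regFibrePr F n K hnK.le e V →
        (∀ γ : ℝ → GaugeField (F.P K) 0 (Matrix.specialUnitaryGroup (Fin 2) ℂ), γ 0 = W → (∀ t, γ t ∈ fibre F ℰp n K hnK.le V) →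
          (∀ b, DifferentiableAt ℝ (fun t => ((γ t b : Matrix.specialUnitaryGroup (Fin 2) ℂ) : Matrix (Fin 2) (Fin 2) ℂ)) 0) →
            deriv (fun t => wilsonAction4 (γ t)) 0 = 0) →
        In19 F n K (2 * B₁' * e) W (expHermField X) X → AvgCondPrint F n K hnK.le V W X → IsLandauPrint F n K W X →
          ∃ dv : ℝ, ∑ ĉ : PBond (F.P n) 0, ‖CmapTw F n K hnK.le W (fun b => Complex.I • X b) ĉ‖
              ≤ C₁ * ((F.L : ℝ) ^ (K - n))⁻¹ * (∑ b : PBond (F.P K) 0, ‖X b‖ ^ 2) + C₂ * ((F.L : ℝ) ^ (K - n)) * ((∑ p : Plaq (F.P K) 0, ‖((Complex.I • X ⟨p.src, p.μ⟩) + ((W ⟨p.src, p.μ⟩ : Matrix (Fin 2) (Fin 2) ℂ) * (Complex.I • X ⟨p.src.shift p.μ, p.ν⟩) * star (W ⟨p.src, p.μ⟩ : Matrix (Fin 2) (Fin 2) ℂ))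
            - (((W ⟨p.src, p.μ⟩ * W ⟨p.src.shift p.μ, p.ν⟩ * (W ⟨p.src.shift p.ν, p.μ⟩)⁻¹ : Matrix.specialUnitaryGroup (Fin 2) ℂ) : Matrix (Fin 2) (Fin 2) ℂ) * (Complex.I • X ⟨p.src.shift p.ν, p.μ⟩) * star ((W ⟨p.src, p.μ⟩ * W ⟨p.src.shift p.μ, p.ν⟩ * (W ⟨p.src.shift p.ν, p.μ⟩)⁻¹ : Matrix.specialUnitaryGroup (Fin 2) ℂ) : Matrix (Fin 2) (Fin 2) ℂ))
            - (((GaugeField.plaqHol W p : Matrix.specialUnitaryGroup (Fin 2) ℂ) : Matrix (Fin 2) (Fin 2) ℂ) * (Complex.I • X ⟨p.src, p.ν⟩) * star ((GaugeField.plaqHol W p : Matrix.specialUnitaryGroup (Fin 2) ℂ) : Matrix (Fin 2) (Fin 2) ℂ)))‖ ^ 2) + dv) ∧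
            dv ≤ ζ * (∑ p : Plaq (F.P K) 0, ‖((Complex.I • X ⟨p.src, p.μ⟩) + ((W ⟨p.src, p.μ⟩ : Matrix (Fin 2) (Fin 2) ℂ) * (Complex.I • X ⟨p.src.shift p.μ, p.ν⟩) * star (W ⟨p.src, p.μ⟩ : Matrix (Fin 2) (Fin 2) ℂ))
            - (((W ⟨p.src, p.μ⟩ * W ⟨p.src.shift p.μ, p.ν⟩ * (W ⟨p.src.shift p.ν, p.μ⟩)⁻¹ : Matrix.specialUnitaryGroup (Fin 2) ℂ) : Matrix (Fin 2) (Fin 2) ℂ) * (Complex.I • X ⟨p.src.shift p.ν, p.μ⟩) * star ((W ⟨p.src, p.μ⟩ * W ⟨p.src.shift p.μ, p.ν⟩ * (W ⟨p.src.shift p.ν, p.μ⟩)⁻¹ : Matrix.specialUnitaryGroup (Fin 2) ℂ) : Matrix (Fin 2) (Fin 2) ℂ))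
            - (((GaugeField.plaqHol W p : Matrix.specialUnitaryGroup (Fin 2) ℂ) : Matrix (Fin 2) (Fin 2) ℂ) * (Complex.I • X ⟨p.src, p.ν⟩) * star ((GaugeField.plaqHol W p : Matrix.specialUnitaryGroup (Fin 2) ℂ) : Matrix (Fin 2) (Fin 2) ℂ)))‖ ^ 2) + δ₁ * (((F.L : ℝ) ^ (K - n)) ^ 2)⁻¹ * (∑ b : PBond (F.P K) 0, ‖X b‖ ^ 2) :=
  hPA2_of_diffL1 hD_holds

/-! ## §3 The E′ growth socket re-read: `hcoS ⟸ (N06)ᶜ` alone -/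

section GrowthFromN06

variable (c₀ cB a₀ : ℕ → ℝ) [hc₀ : ∀ L : ℕ, Fact (0 < c₀ L)] [hcB : ∀ L : ℕ, Fact (0 < cB L)]

/-- ★★ **THE GROWTH ROW (141)–(142) `hcoS` FROM (N06)ᶜ ALONE** — ★p1 g18 ✓`Prop7HcoSOfNormG0DiffRow.hcoS_of_normG0_of_diffL1 (ha₀) (hN06) (hD)` with `hD := hD_holds`:
binders `ha₀`, `hN06` and the conclusion VERBATIM ([Balaban1985BackgroundPropagators] Thm 3.11's inverse `G₀` of `Δ_a` at the comb slots, bounded by `B₀`, is the ONE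
remaining labelled input of the growth socket; in the EX display it is descended through the lane-II door ✓`Prop7HcoOfDivRecovery.hN06_of_divRecovery`).
[cite: Balaban1985Variational, (141)-(142) p.299, (44)-(47) pp.285-286; Balaban1985BackgroundPropagators, Thm 3.11 p.416] -/
theorem hcoS_of_hN06 (ha₀ : ∀ L : ℕ, 0 ≤ a₀ L)
    (hN06 : ∀ (L : ℕ), 1 < L → ∃ B₀ eN : ℝ, 0 < B₀ ∧ 0 < eN ∧
      ∀ (F : T3Family), F.L = L → ∀ (n K : ℕ) (hnK : n < K) (e : ℝ) (W : GaugeField (F.P K) 0 (Matrix.specialUnitaryGroup (Fin 2) ℂ)),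
        0 < e → e ≤ eN → RegPr F n K e W →
        ∃ G₀ : BondL2K ℂ 3 (periodsT3 F K) (c₀ F.L) W₂ →ₗ[ℂ] BondL2K ℂ 3 (periodsT3 F K) (c₀ F.L) W₂,
          laplaceAK (DeltaEtaSlot F n K (c₀ F.L) W) (DL2 F n K (c₀ F.L) W) (RcombL2 F n K (c₀ F.L) W) (DstarL2 F n K (c₀ F.L) W)
              (Qkc F n K hnK.le (c₀ F.L) (cB F.L) W) (LinearMap.adjoint (Qkc F n K hnK.le (c₀ F.L) (cB F.L) W))
              (((a₀ F.L * (c₀ F.L / cB F.L) * ((F.L : ℝ) ^ (K - n)) ^ 3 : ℝ) : ℂ)) ∘ₗ G₀ = LinearMap.id ∧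
          ∀ f, ‖G₀ f‖ ≤ B₀ * ‖f‖) :
    ∀ (L : ℕ), 1 < L → ∀ (B₁' : ℝ), 0 < B₁' → ∃ e₇ : ℝ, 0 < e₇ ∧
      ∀ (F : T3Family), F.L = L → ∀ (n K : ℕ) (hnK : n < K) (e : ℝ) (V : GaugeField (F.P n) 0 (Matrix.specialUnitaryGroup (Fin 2) ℂ))
        (W : GaugeField (F.P K) 0 (Matrix.specialUnitaryGroup (Fin 2) ℂ)) (X : PBond (F.P K) 0 → Matrix (Fin 2) (Fin 2) ℂ),
        0 < e → e ≤ e₇ → W ∈ regFibrePr F n K hnK.le e V →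
        (∀ γ : ℝ → GaugeField (F.P K) 0 (Matrix.specialUnitaryGroup (Fin 2) ℂ), γ 0 = W → (∀ t, γ t ∈ fibre F ℰp n K hnK.le V) →
          (∀ b, DifferentiableAt ℝ (fun t => ((γ t b : Matrix.specialUnitaryGroup (Fin 2) ℂ) : Matrix (Fin 2) (Fin 2) ℂ)) 0) →
            deriv (fun t => wilsonAction4 (γ t)) 0 = 0) →
        In19 F n K (2 * B₁' * e) W (expHermField X) X → AvgCondPrint F n K hnK.le V W X → IsLandauPrint F n K W X →
          wilsonAction4 W ≤ wilsonAction4 (emb15 W (expHermField X)) :=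
  hcoS_of_normG0_of_diffL1 c₀ cB a₀ ha₀ hN06 hD_holds

end GrowthFromN06

end Summit.QuantumFields.YangMills.Theorems.Prop7PA2Holds

end
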